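import Mathlib
import HarnessLib
import Summits.AtomisticToContinuum.FouriersLaw.Theses.JunctionLocality
import Literature.MathematicalPhysics.KineticTheory.LangevinChainGibbs
import Literature.MathematicalPhysics.KineticTheory.LangevinChainNESSProofs
import Literature.Probability.Distributions.GaussianPoincare
import Literature.Probability.Distributions.GaussianPoincareVariance
import Literature.Probability.Distributions.GaussianPiDensity
import Summits.AtomisticToContinuum.FouriersLaw.Theorems.BondHeatUncertaintyExtensiveSnapshotIrreversibilityOddFibrePoincare

/-!
# Stub `stub_farMomentumPoincare` of line `far-contact-fisher-square`
(crux stmt-AtomisticToContinuum-11749 `JunctionLocality.ConductanceLowerBound`) — PROVED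

The single-momentum Gaussian Poincaré inequality, RESAMPLING (two-point / interpolation) form, under
the kinetic Gibbs measure of an ARBITRARY oscillator chain `Q` at temperature `T > 0` and an
arbitrary site `i`: for `f ∈ C¹` with `∂_{p_i} f ∈ L²(μ_T)`, `μ_T = Q.gibbsMeasure N T`,

  `∫ dμ_T(x) ∫ d𝒩(0,T)(s) (f(x) − f(q, p[i ↦ s]))² ≤ (π²/4)·T·∫ (∂_{p_i} f)² dμ_T`.

## Proof

All in `ℝ≥0∞`, converted to Bochner integrals at the end (template: the landed fibrewise odd
Poincaré inequality `…ExtensiveSnapshotIrreversibility.ClausiusBudget.oddFibrePoincare`).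
`μ_T = volume.tilted (−H/T)` (`lintegral_tilted`; the zero measure if `e^{−H/T}` is not integrable,
in which case both sides vanish), `H = Σ p²/2 + Φ(q)` (`hamiltonian_eq_kinetic_add_potential`), so
`e^{−H/T} = e^{−Φ(q)/T}·e^{−|p|²/2T}` and Tonelli reduces the claim to the momentum fibres; on a fibre
`e^{−|p|²/2T} dp` is a constant multiple of the product Gaussian `γ_N = 𝒩(0, T I_N)`
(`pi_gaussianReal_eq_smul_withDensity`), and the claim becomes the pure product-Gaussian statement
`∫ dγ_N(p) ∫ d𝒩(s) (φ p − φ (p[i ↦ s]))² ≤ (π²/4) T ∫ (∂_i φ)² dγ_N` for `φ = f(q, ·)`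
(`lintegral_resample_sq_le_pi_gaussianReal`). Integrating out the coordinate `i` first
(`lintegral_le_of_lmarginal_le`, `lmarginal_singleton`: `∫ h dγ_N = ∫ dγ_N(p) ∫ d𝒩(t) h(p[i ↦ t])`)
turns both sides into `γ_N`-averages of ONE-dimensional quantities for `g_p(t) = φ(p[i ↦ t])`, namely
`∫∫ (g_p t − g_p s)² d𝒩 d𝒩` and `∫ (g_p')² d𝒩` (`∂_{p_i} f (q, p[i ↦ t]) = g_p'(t)` by the very
definition of `partialP`), and the one-dimensional interpolation Poincaré inequality
`∫∫ (g t − g s)² ≤ (π²/4) v ∫ (g')²` (`lintegral_sq_sub_le_gaussianReal`, the tree's `n`-dimensional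
`lintegral_sq_sub_le_pi_gaussianReal` at `n = 1` transported along `ℝ^{Fin 1} ≃ ℝ`) closes each
fibre. The `L²` hypothesis on `∂_{p_i} f` makes the right side finite (needed to pass to real
integrals); on the left, an inner Bochner integral that fails to converge is `0 ≤` its `ℝ≥0∞`
version, the safe direction. Sources: Gaussian Poincaré inequality by Pisier's rotation argument
(folklore, vendored in `Literature/Probability/Distributions/GaussianPoincare.lean`); fibrewise use
for kinetic Gibbs measures as in Villani, *Hypocoercivity* (Mem. AMS 2009), §7.
-/

noncomputable section

namespace Summit.AtomisticToContinuum.FouriersLaw.Cruxes.ConductanceLowerBound.FarContactFisherSquare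

open MeasureTheory Filter Topology ProbabilityTheory
open scoped ContDiff NNReal ENNReal
open Literature.MathematicalPhysics.KineticTheory.HeatConduction
open Literature.Probability.Distributions

/-! ### One-dimensional Gaussian Poincaré inequality -/

/-- **One-dimensional Gaussian Poincaré inequality, interpolation form.** For `g ∈ C¹(ℝ)` and
`𝒩 = 𝒩(0, v)`: `∫∫ (g t − g s)² d𝒩(s) d𝒩(t) ≤ (π²/4) v ∫ (g')² d𝒩` in `[0, ∞]` (the tree's
`n`-dimensional `lintegral_sq_sub_le_pi_gaussianReal` at `n = 1`, transported along the measurable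
equivalence `ℝ^{Fin 1} ≃ ℝ`, `measurePreserving_funUnique`). [folklore] -/
theorem lintegral_sq_sub_le_gaussianReal (v : ℝ≥0) {g : ℝ → ℝ} (hg : ContDiff ℝ 1 g) :
    ∫⁻ t, ∫⁻ s, ENNReal.ofReal ((g t - g s) ^ 2) ∂(gaussianReal 0 v) ∂(gaussianReal 0 v) ≤
      ENNReal.ofReal (Real.pi ^ 2 / 4 * v) *
        ∫⁻ t, ENNReal.ofReal (deriv g t ^ 2) ∂(gaussianReal 0 v) := by
  have hmp : MeasurePreserving (MeasurableEquiv.funUnique (Fin 1) ℝ)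
      (Measure.pi fun _ : Fin 1 => gaussianReal 0 v) (gaussianReal 0 v) :=
    measurePreserving_funUnique (gaussianReal 0 v) (Fin 1)
  have hφ : ContDiff ℝ 1 fun x : Fin 1 → ℝ => g (x default) :=
    hg.comp (contDiff_apply ℝ ℝ default)
  have hder : ∀ x : Fin 1 → ℝ,
      ∑ j, (fderiv ℝ (fun x : Fin 1 → ℝ => g (x default)) x (Pi.single j 1)) ^ 2 =
        deriv g (x default) ^ 2 := by
    intro x
    have h : HasFDerivAt (fun x : Fin 1 → ℝ => g (x default))
        (deriv g (x default) • ContinuousLinearMap.proj (R := ℝ) (φ := fun _ : Fin 1 => ℝ) default) x :=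
      ((hg.differentiable one_ne_zero) _).hasDerivAt.comp_hasFDerivAt x (hasFDerivAt_apply default x)
    rw [Fintype.sum_unique, h.fderiv]
    simp
  have key := lintegral_sq_sub_le_pi_gaussianReal v hφ
  simp only [hder] at key
  simp_rw [hmp.lintegral_map_equiv]
  exact key

/-! ### The product-Gaussian statement: resampling one coordinate -/

/-- **Single-coordinate Gaussian Poincaré inequality, resampling form, product Gaussian.** For
`f ∈ C¹` on phase space, a position `q`, a site `i` and `γ_N = 𝒩(0, v I_N)`, `𝒩 = 𝒩(0, v)`:
`∫ dγ_N(p) ∫ d𝒩(s) (f(q,p) − f(q, p[i ↦ s]))² ≤ (π²/4) v ∫ (∂_{p_i} f (q,p))² dγ_N(p)` in `[0, ∞]`.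
Integrate out coordinate `i` first (`lintegral_le_of_lmarginal_le`); on each line
`t ↦ p[i ↦ t]` this is the one-dimensional `lintegral_sq_sub_le_gaussianReal` for
`g(t) = f(q, p[i ↦ t])`, whose derivative is `∂_{p_i} f (q, p[i ↦ t])` by definition of `partialP`.
[folklore] -/
theorem lintegral_resample_sq_le_pi_gaussianReal {N : ℕ} (v : ℝ≥0) (i : Fin N)
    {f : PhaseSpace N → ℝ} (hf : ContDiff ℝ 1 f) (q : Fin N → ℝ) :
    ∫⁻ p, ∫⁻ s, ENNReal.ofReal ((f (q, p) - f (q, Function.update p i s)) ^ 2) ∂(gaussianReal 0 v)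
        ∂(Measure.pi fun _ : Fin N => gaussianReal 0 v) ≤
      ENNReal.ofReal (Real.pi ^ 2 / 4 * v) *
        ∫⁻ p, ENNReal.ofReal (partialP i f (q, p) ^ 2) ∂(Measure.pi fun _ : Fin N => gaussianReal 0 v) := by
  have hfc : Continuous f := hf.continuous
  have hFm : Measurable fun p : Fin N → ℝ =>
      ∫⁻ s, ENNReal.ofReal ((f (q, p) - f (q, Function.update p i s)) ^ 2) ∂(gaussianReal 0 v) := by
    refine Measurable.lintegral_prod_right ?_
    exact (ENNReal.continuous_ofReal.comp (((hfc.comp (continuous_const.prodMk continuous_fst)).sub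
      (hfc.comp (continuous_const.prodMk (continuous_fst.update i continuous_snd)))).pow 2)).measurable
  have hPc : Continuous fun p : Fin N → ℝ => partialP i f (q, p) :=
    (continuous_partialP hf one_ne_zero i).comp (Continuous.prodMk_right q)
  have hGm : Measurable fun p : Fin N → ℝ =>
      ENNReal.ofReal (Real.pi ^ 2 / 4 * v) * ENNReal.ofReal (partialP i f (q, p) ^ 2) :=
    ((hPc.pow 2).measurable.ennreal_ofReal).const_mul _
  rw [← lintegral_const_mul' _ _ ENNReal.ofReal_ne_top]
  refine lintegral_le_of_lmarginal_le {i} hFm hGm fun p => ?_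
  rw [lmarginal_singleton, lmarginal_singleton]
  simp only [Function.update_idem]
  have hd : ∀ t, partialP i f (q, Function.update p i t) =
      deriv (fun t => f (q, Function.update p i t)) t := by
    intro t
    simp only [partialP, Function.update_idem, Function.update_self]
  simp only [hd]
  rw [lintegral_const_mul' _ _ ENNReal.ofReal_ne_top]
  exact lintegral_sq_sub_le_gaussianReal v
    (hf.comp ((contDiff_const (c := q)).prodMk (contDiff_update 1 p i)))

/-- **Single-coordinate Gaussian Poincaré inequality, resampling form, Lebesgue-density version.**
For `T > 0`, `f ∈ C¹` on phase space, a position `q` and a site `i`: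
`∫ e^{-|p|²/2T} (∫ d𝒩(0,T)(s) (f(q,p) − f(q,p[i ↦ s]))²) dp ≤ (π²/4) T ∫ e^{-|p|²/2T} (∂_{p_i}f(q,p))² dp`
in `[0, ∞]` (from `lintegral_resample_sq_le_pi_gaussianReal` and
`𝒩(0, T I_N) = (2πT)^{-N/2} e^{-|p|²/2T} dp`, `pi_gaussianReal_eq_smul_withDensity`). [folklore] -/
theorem lintegral_resample_sq_gaussianWeight_le {N : ℕ} {T : ℝ} (hT : 0 < T) (i : Fin N)
    {f : PhaseSpace N → ℝ} (hf : ContDiff ℝ 1 f) (q : Fin N → ℝ) :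
    ∫⁻ p, ENNReal.ofReal (Real.exp (-(∑ j, p j ^ 2 / 2) / T)) *
        ∫⁻ s, ENNReal.ofReal ((f (q, p) - f (q, Function.update p i s)) ^ 2) ∂(gaussianReal 0 T.toNNReal) ≤
      ENNReal.ofReal (Real.pi ^ 2 / 4 * T) * ∫⁻ p, ENNReal.ofReal (Real.exp (-(∑ j, p j ^ 2 / 2) / T)) *
        ENNReal.ofReal (partialP i f (q, p) ^ 2) := by
  obtain ⟨v, rfl⟩ : ∃ v : ℝ≥0, (v : ℝ) = T := ⟨⟨T, hT.le⟩, rfl⟩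
  rw [Real.toNNReal_coe]
  have hv0 : v ≠ 0 := by
    rintro rfl
    simp at hT
  have hfc : Continuous f := hf.continuous
  have hWm : Measurable fun w : Fin N → ℝ => ENNReal.ofReal (Real.exp (-(∑ j, w j ^ 2 / 2) / (v : ℝ))) := by
    fun_prop
  have hm1 : Measurable fun p : Fin N → ℝ =>
      ∫⁻ s, ENNReal.ofReal ((f (q, p) - f (q, Function.update p i s)) ^ 2) ∂(gaussianReal 0 v) := by
    refine Measurable.lintegral_prod_right ?_
    exact (ENNReal.continuous_ofReal.comp (((hfc.comp (continuous_const.prodMk continuous_fst)).sub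
      (hfc.comp (continuous_const.prodMk (continuous_fst.update i continuous_snd)))).pow 2)).measurable
  have hm2 : Measurable fun p : Fin N → ℝ => ENNReal.ofReal (partialP i f (q, p) ^ 2) :=
    (((continuous_partialP hf one_ne_zero i).comp (Continuous.prodMk_right q)).pow 2).measurable.ennreal_ofReal
  have key := lintegral_resample_sq_le_pi_gaussianReal v i hf q
  rw [pi_gaussianReal_eq_smul_withDensity N hv0, lintegral_smul_measure, lintegral_smul_measure,
    lintegral_withDensity_eq_lintegral_mul _ hWm hm1, lintegral_withDensity_eq_lintegral_mul _ hWm hm2] at key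
  simp only [Pi.mul_apply] at key
  have hc0 : ENNReal.ofReal ((Real.sqrt (2 * Real.pi * (v : ℝ)))⁻¹ ^ N) ≠ 0 :=
    (ENNReal.ofReal_pos.2 (by positivity)).ne'
  exact (ENNReal.mul_le_mul_iff_right hc0 ENNReal.ofReal_ne_top).1 (key.trans_eq (mul_left_comm _ _ _))

/-! ### From `ℝ≥0∞` to Bochner integrals -/

/-- For a nonnegative `g`, `ENNReal.ofReal (∫ g dμ) ≤ ∫⁻ ENNReal.ofReal g dμ` (equality if `g` is
integrable, and the left side is `0` otherwise). [folklore] -/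
theorem ofReal_integral_le_lintegral_ofReal {α : Type*} [MeasurableSpace α] (μ : Measure α)
    {g : α → ℝ} (hg : ∀ x, 0 ≤ g x) :
    ENNReal.ofReal (∫ x, g x ∂μ) ≤ ∫⁻ x, ENNReal.ofReal (g x) ∂μ := by
  by_cases hgi : Integrable g μ
  · rw [ofReal_integral_eq_lintegral_ofReal hgi (ae_of_all _ hg)]
  · rw [integral_undef hgi, ENNReal.ofReal_zero]
    exact zero_le

/-! ### The registered stub -/

/-- **P — FAR-MOMENTUM GAUSSIAN POINCARÉ, resampling form** (stub `stub_farMomentumPoincare` of line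
`far-contact-fisher-square`, crux stmt-AtomisticToContinuum-11749).  For ANY oscillator chain `Q`,
`N` sites, `T > 0`, a site `i` and `f ∈ C¹` with `f, ∂_{p_i} f ∈ L²(μ_T)`
(`μ_T = Q.gibbsMeasure N T = Z⁻¹ e^{−H/T} dq dp`, `H = Σ p²/2 + Φ(q)`):
`∫ dμ_T(x) ∫ d𝒩(0,T)(s) (f(x) − f(q, p[i ↦ s]))² ≤ (π²/4)·T·∫ (∂_{p_i} f)² dμ_T`.
Proof: `e^{−H/T}` factorises (`lintegral_tilted`, `hamiltonian_eq_kinetic_add_potential`), Tonelli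
reduces to the momentum fibres, where `e^{−|p|²/2T} dp ∝ 𝒩(0, T I_N)` and the fibre statement is
`lintegral_resample_sq_gaussianWeight_le` (one-dimensional interpolation Poincaré on each line
`t ↦ p[i ↦ t]`, constant `π²/4 · T`, from the tree's `lintegral_sq_sub_le_pi_gaussianReal`); the `L²`
hypothesis on `∂_{p_i} f` converts `ℝ≥0∞` to Bochner. If `e^{−H/T}` is not integrable both sides
vanish. The left side is `2·E_μ[Var(f | q, p_{≠ i})]`. [folklore] (Gaussian Poincaré: Pisier's
rotation argument; fibrewise use as in Villani, *Hypocoercivity*, 2009, §7) -/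
theorem stub_farMomentumPoincare :
    ∀ (Q : OscillatorChain) (N : ℕ) (T : ℝ), 0 < T → ∀ (i : Fin N) (f : PhaseSpace N → ℝ),
      ContDiff ℝ 1 f → MemLp f 2 (Q.gibbsMeasure N T) →
      MemLp (fun x => partialP i f x) 2 (Q.gibbsMeasure N T) →
      ∫ x, (∫ s, (f x - f (x.1, Function.update x.2 i s)) ^ 2 ∂(gaussianReal 0 T.toNNReal)) ∂(Q.gibbsMeasure N T) ≤
        Real.pi ^ 2 / 4 * T * ∫ x, (partialP i f x) ^ 2 ∂(Q.gibbsMeasure N T) := by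
  intro Q N T hT i f hf _ hgrad
  -- the non-integrable case: `μ_T = 0`
  by_cases hint : Integrable (Q.gibbsDensity N T)
  swap
  · rw [Q.gibbsMeasure_of_not_integrable hint]
    simp
  set ν : Measure ℝ := gaussianReal 0 T.toNNReal with hν
  -- regularity
  have hfc : Continuous f := hf.continuous
  have hPc : Continuous (partialP i f) := continuous_partialP hf one_ne_zero i
  have hFc : Continuous fun z : PhaseSpace N × ℝ =>
      (f z.1 - f (z.1.1, Function.update z.1.2 i z.2)) ^ 2 :=
    ((hfc.comp continuous_fst).sub (hfc.comp ((continuous_fst.comp continuous_fst).prodMk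
      ((continuous_snd.comp continuous_fst).update i continuous_snd)))).pow 2
  have hAm : Measurable fun x : PhaseSpace N =>
      ∫⁻ s, ENNReal.ofReal ((f x - f (x.1, Function.update x.2 i s)) ^ 2) ∂ν :=
    Measurable.lintegral_prod_right (ENNReal.measurable_ofReal.comp hFc.measurable)
  -- the fibrewise inequality
  have hfibre : ∀ q : Fin N → ℝ,
      ∫⁻ p, ENNReal.ofReal (Real.exp (-(∑ j, p j ^ 2 / 2) / T)) *
          ∫⁻ s, ENNReal.ofReal ((f (q, p) - f (q, Function.update p i s)) ^ 2) ∂ν ≤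
        ENNReal.ofReal (Real.pi ^ 2 / 4 * T) * ∫⁻ p, ENNReal.ofReal (Real.exp (-(∑ j, p j ^ 2 / 2) / T)) *
          ENNReal.ofReal (partialP i f (q, p) ^ 2) := fun q =>
    lintegral_resample_sq_gaussianWeight_le hT i hf q
  -- measurability of the factorised weight `e^{-Φ(q)/T} · e^{-|p|²/2T}`
  have hWm : Measurable fun p : Fin N → ℝ => ENNReal.ofReal (Real.exp (-(∑ j, p j ^ 2 / 2) / T)) := by
    fun_prop
  have heM : AEMeasurable (fun x : PhaseSpace N => ENNReal.ofReal (Real.exp (-Q.potential N x.1 / T)))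
      ((volume : Measure (Fin N → ℝ)).prod volume) := by
    have e : (fun x : PhaseSpace N => ENNReal.ofReal (Real.exp (-Q.potential N x.1 / T))) =
        fun x => ENNReal.ofReal (Q.gibbsDensity N T x * Real.exp ((∑ j, x.2 j ^ 2 / 2) / T)) := by
      funext x
      rw [OscillatorChain.gibbsDensity, ← Real.exp_add, Q.hamiltonian_eq_kinetic_add_potential]
      congr 2
      ring
    rw [e, ← Measure.volume_eq_prod]
    exact (hint.aemeasurable.mul (by fun_prop : Measurable fun x : PhaseSpace N =>
      Real.exp ((∑ j, x.2 j ^ 2 / 2) / T)).aemeasurable).ennreal_ofReal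
  have hXm : AEMeasurable (fun x : PhaseSpace N => ENNReal.ofReal (Real.exp (-Q.potential N x.1 / T)) *
      (ENNReal.ofReal (Real.exp (-(∑ j, x.2 j ^ 2 / 2) / T)) *
        ∫⁻ s, ENNReal.ofReal ((f x - f (x.1, Function.update x.2 i s)) ^ 2) ∂ν))
      ((volume : Measure (Fin N → ℝ)).prod volume) :=
    heM.mul ((hWm.comp measurable_snd).mul hAm).aemeasurable
  have hYm : AEMeasurable (fun x : PhaseSpace N => ENNReal.ofReal (Real.exp (-Q.potential N x.1 / T)) *
      (ENNReal.ofReal (Real.exp (-(∑ j, x.2 j ^ 2 / 2) / T)) * ENNReal.ofReal (partialP i f x ^ 2)))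
      ((volume : Measure (Fin N → ℝ)).prod volume) :=
    heM.mul ((hWm.comp measurable_snd).mul (hPc.pow 2).measurable.ennreal_ofReal).aemeasurable
  -- the inequality in `ℝ≥0∞` under `μ_T`: factorise the weight, Tonelli, fibrewise Poincaré
  have core : ∫⁻ x, (∫⁻ s, ENNReal.ofReal ((f x - f (x.1, Function.update x.2 i s)) ^ 2) ∂ν)
        ∂(Q.gibbsMeasure N T) ≤
      ENNReal.ofReal (Real.pi ^ 2 / 4 * T) *
        ∫⁻ x, ENNReal.ofReal (partialP i f x ^ 2) ∂(Q.gibbsMeasure N T) := by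
    have hw : ∀ (c : ℝ) (x : PhaseSpace N), ENNReal.ofReal (Real.exp (-Q.hamiltonian N x / T) / c) =
        ENNReal.ofReal c⁻¹ * (ENNReal.ofReal (Real.exp (-Q.potential N x.1 / T)) *
          ENNReal.ofReal (Real.exp (-(∑ j, x.2 j ^ 2 / 2) / T))) := by
      intro c x
      have hsplit : Real.exp (-Q.hamiltonian N x / T) =
          Real.exp (-Q.potential N x.1 / T) * Real.exp (-(∑ j, x.2 j ^ 2 / 2) / T) := by
        rw [← Real.exp_add, Q.hamiltonian_eq_kinetic_add_potential]
        congr 1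
        ring
      rw [hsplit, div_eq_mul_inv _ c, mul_comm _ c⁻¹, ENNReal.ofReal_mul' (by positivity),
        ENNReal.ofReal_mul (Real.exp_pos _).le]
    rw [Q.gibbsMeasure_eq, lintegral_tilted, lintegral_tilted]
    simp_rw [hw, mul_assoc]
    rw [lintegral_const_mul' _ _ ENNReal.ofReal_ne_top, lintegral_const_mul' _ _ ENNReal.ofReal_ne_top,
      mul_left_comm (ENNReal.ofReal (Real.pi ^ 2 / 4 * T))]
    gcongr
    rw [Measure.volume_eq_prod, lintegral_prod _ hXm, lintegral_prod _ hYm]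
    dsimp only
    simp_rw [lintegral_const_mul' _ _ ENNReal.ofReal_ne_top]
    rw [← lintegral_const_mul' (ENNReal.ofReal (Real.pi ^ 2 / 4 * T)) _ ENNReal.ofReal_ne_top]
    refine lintegral_mono fun q => ?_
    rw [mul_left_comm]
    exact mul_le_mul' le_rfl (hfibre q)
  -- finiteness of the right-hand side: `∂_{p_i} f ∈ L²(μ_T)`
  have hB : ∫⁻ x, ENNReal.ofReal (partialP i f x ^ 2) ∂(Q.gibbsMeasure N T) ≠ ⊤ :=
    (hgrad.integrable_sq.lintegral_lt_top).ne
  -- back to Bochner integrals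
  have hL : ∫ x, (∫ s, (f x - f (x.1, Function.update x.2 i s)) ^ 2 ∂ν) ∂(Q.gibbsMeasure N T) =
      (∫⁻ x, ENNReal.ofReal (∫ s, (f x - f (x.1, Function.update x.2 i s)) ^ 2 ∂ν)
        ∂(Q.gibbsMeasure N T)).toReal :=
    integral_eq_lintegral_of_nonneg_ae (ae_of_all _ fun x => integral_nonneg fun s => sq_nonneg _)
      (hFc.stronglyMeasurable.integral_prod_right' (ν := ν)).aestronglyMeasurable
  have hR : ∫ x, partialP i f x ^ 2 ∂(Q.gibbsMeasure N T) =
      (∫⁻ x, ENNReal.ofReal (partialP i f x ^ 2) ∂(Q.gibbsMeasure N T)).toReal :=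
    integral_eq_lintegral_of_nonneg_ae (ae_of_all _ fun x => sq_nonneg _) (hPc.pow 2).aestronglyMeasurable
  rw [hL, hR, ← ENNReal.toReal_ofReal (by positivity : (0 : ℝ) ≤ Real.pi ^ 2 / 4 * T),
    ← ENNReal.toReal_mul]
  refine ENNReal.toReal_mono (ENNReal.mul_ne_top ENNReal.ofReal_ne_top hB) (le_trans ?_ core)
  exact lintegral_mono fun x => ofReal_integral_le_lintegral_ofReal ν fun s => sq_nonneg _

end Summit.AtomisticToContinuum.FouriersLaw.Cruxes.ConductanceLowerBound.FarContactFisherSquare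

end
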